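import Summits.HodgeConjecture.HodgeConjecture.Theorems.HeckePrymWeilWeilTwelvefoldsSqrtMinus7IsotypicReachLemmas
import Summits.HodgeConjecture.HodgeConjecture.Theorems.HeckePrymWeilHeckePrymAnchorsGlobalClassOfLeray
import Summits.HodgeConjecture.HodgeConjecture.Theorems.HeckePrymWeilHeckePrymAnchorsRationalAlongSection
import Literature.AlgebraicGeometry.HodgeTheory.InvariantClassesFromTotalSpace
import Literature.AlgebraicGeometry.HodgeTheory.WeilFamilyReachSystem
import Literature.AlgebraicGeometry.HodgeTheory.HeckePrymF21WeilTwelvefold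
import Literature.AlgebraicGeometry.Motives.PrymVariety
import Literature.AlgebraicGeometry.Motives.Jacobian
import HarnessLib

/-!
# Crux `WeilTwelvefoldsSqrtMinus7` (stmt-HodgeConjecture-1261), line `isotypic-unimodular-saturation` —
# stub `stub_reach` (REACH) from two named facts and Deligne 1968

Stub 5 of the skeleton `Cruxes/WeilTwelvefoldsSqrtMinus7/Lines/isotypic_unimodular_saturation.lean` is the
MODULI INFRASTRUCTURE of the line: for a `ℚ(√-7)`-Weil twelvefold `(A, φ)` (witnessed by a non-zero
rational `(6,6)` Weil class) a partner Weil surface `B` with a descent pair, and a smooth projective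
family of `ℚ(√-7)`-Weil 14-folds through `A × B` reaching a HECKE–PRYM-PRODUCT anchor fibre, on which
every rational `(7,7)` Weil class of `A × B` globalises to a class that is a rational `(7,7)` Weil class
on every fibre. Classically two pages (PEL Shimura family with neat level, Baily–Borel, Landherr,
Riemann existence, Deligne's partie fixe); the tree constructs no moduli space of abelian varieties, no
universal abelian scheme and no curve of genus `43`, so the stub cannot be closed today. This file
proves the stub from EXACTLY what is missing — two named facts of the tree stated over existing tree
constants (`HodgeTheory/WeilFamilyReachSystem`, `HodgeTheory/HeckePrymF21WeilTwelvefold`) — and from the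
accepted named fact `deligne1968_invariantClass_fromTotalSpace`:

* `weilFamily_hyperbolic_weilSystem_reach` (R1) — Deligne's polarized Weil family over the HYPERBOLIC
  (= split) component, in FAMILY-FIRST form: through a hyperbolic `(P, ψ₀, h_K)` there is ONE embedded
  smooth projective family over a smooth irreducible quasi-projective base, with `ℚ(√-d)`-Weil
  structures `(Y_s, Ψ_s)` on all fibres, along which EVERY Weil class of `P` extends to a flat section
  that is of Hodge type `(n,n)` and a Weil class of `(Y_s, Ψ_s)` on every fibre (the Weil planes form a
  sub-local system with `det = 1` monodromy), and which reaches every hyperbolic `(A, φ, h_K)` up to a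
  `K`-isogeny from a fibre. It is the accepted named fact `weilFamilyReach_hyperbolic`
  ([Deligne1982HodgeCycles, proof of Thm. 4.8]; [vanGeemen1994HodgeAV, §5]; [Landherr1936HermitianForms];
  [MumfordFogartyKirwan1994, Thm. 7.9–7.10]) with the quantifiers in the order the source proves them
  (the family depends on `(P, ψ₀, h_K)` only) and the Weil sub-local system recorded on every fibre.
* `exists_heckePrymDatum_F21` (R2) — an étale `F₂₁`-cover of a complex genus-3 curve exists (Riemann's
  existence theorem) and its Hecke–Prym `P' = ((Prym_N)^{μ₃})⁰` is a `ℚ(√-7)`-Weil twelvefold of type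
  `(6,6)` with `φ'² = -7` (Chevalley–Weil; Lange–Rodríguez), in the literal typing of the skeleton's datum.
* `stub_reach_of_facts` — **the registered signature of `stub_reach`, VERBATIM, from
  `deligne1968_invariantClass_fromTotalSpace`, (R1) and (R2)**. The discriminant bookkeeping of the
  skeleton's informal proof ("weights tune `δ(P' × B')` onto `δ(A × B)`, Landherr") is DISCHARGED by the
  tree: the sibling line's aiming theorem (`exists_cmSquare_descentPair_algebraic_aiming`, from
  `stub_aimedFrameOfModel` + Hodge–Riemann in degree one) puts BOTH `A × B` and `P' × B` — `B` the CM
  square `E × E`, `E = ℂ/(ℤ + ℤ√-7)`, with `([√-7], -[√-7])`, whose Weil plane is algebraic — on the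
  HYPERBOLIC component, so only the hyperbolic family (R1) is needed; the flat Weil section is globalised
  by the W-engine `stub_globalClassOfSection_of_leray` (Deligne 1968) and is rational everywhere by
  `stub_rationalAlongSection`.

CONDITIONAL on the three hypotheses, which are spelled out; nothing else is assumed; no `sorry`.
-/

noncomputable section

-- single-problem summit (Problem = Summit): the mandated namespace repeats `HodgeConjecture`.
set_option linter.dupNamespace false

open CategoryTheory
open Literature.AlgebraicGeometry Literature.AlgebraicGeometry.Motives
  Literature.AlgebraicGeometry.HodgeTheory Literature.AlgebraicTopology.SingularHomology
open Summit.HodgeConjecture.HodgeConjecture.Theorems.HeckePrymWeilLine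
  (stub_upgrade stub_rationalAlongSection stub_globalClassOfSection_of_leray)

namespace Summit.HodgeConjecture.HodgeConjecture.Theorems.WeilTwelvefoldsSqrtMinus7.IsotypicUnimodularSaturation

/-! ### The registered stub from the facts -/

/-- **Stub 5 (`stub_reach`) of line `isotypic-unimodular-saturation`, VERBATIM, from Deligne 1968
(`deligne1968_invariantClass_fromTotalSpace`), the hyperbolic Weil family (R1) and the `F₂₁`-datum
(R2).** Proof. Partner: the CM square `B = E × E` with `φ_B = ([√-7], -[√-7])`, its descent pair, its
ALGEBRAIC single-operator Weil plane and the AIMING property (`exists_cmSquare_descentPair_algebraic_aiming`).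
Aiming at `n = 6` with the crux's witness makes `(A × B, φ × φ_B)` HYPERBOLIC for a `K`-symmetrised
hyperplane class, so (R1) at `(n, d) = (7, 7)` gives the family `f : 𝒳 → S` through `A × B` with fibre
structures `(Y_s, Ψ_s, ε_s)`, flat Weil sections and reach. For a rational `(7,7)` class `u` of the
single-operator Weil plane of `A × B`: `u` lies in the strong plane (`stub_upgrade`, `p = 7`, `k = 7`),
so it has a flat section `σ`, fibrewise Hodge `(7,7)` and fibrewise Weil; the W-engine
`stub_globalClassOfSection_of_leray` (fed with Deligne 1968) globalises `σ` to ONE class `𝒰` on `𝒳`,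
whose restrictions are `σ(s)` — at `s₁` the class `e₁^{-1*}u`, rational everywhere by
`stub_rationalAlongSection`, of type `(7,7)` and in the single-operator Weil plane of `(Y_s, Ψ_s)`
(`mem_eigenspace_sup_of_mem_weilClassesOf`) everywhere. Anchor: (R2) gives the Hecke–Prym `(P', φ')`,
a Weil twelvefold of type `(6,6)`; aiming again makes `(P' × B, φ' × φ_B)` hyperbolic, so (R1)'s reach
clause yields a fibre `(Y_{s₀}, Ψ_{s₀})` with an isogeny pair towards `P' × B` — a Hecke–Prym-product
anchor with `B' = B` (Weil surface with algebraic Weil plane) — on which `𝒰` restricts into the Weil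
plane. [cite: Deligne1982HodgeCycles, proof of Thm. 4.8 (pp. 47–52) with Prop. 4.4]
[cite: vanGeemen1994HodgeAV, §5] [cite: Markman2025SurveySecant, §11.5 Step 2]
[cite: VoisinHodgeII2003, Thm. 4.18] -/
theorem stub_reach_of_facts (hL : deligne1968_invariantClass_fromTotalSpace)
    (hR : weilFamily_hyperbolic_weilSystem_reach) (hP : exists_heckePrymDatum_F21) :
    ∀ (A : AbelianVariety ℂ) (φ : A ⟶ A), A.dim = 12 → φ ≫ φ = -((7 : ℤ) • 𝟙 A) →
    (∃ c : complexBetti A.X 12, c ≠ 0 ∧ IsRationalClass c ∧ IsOfHodgeType 12 A.X 12 6 6 c ∧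
      c ∈ Module.End.eigenspace (complexBetti.map (𝟙 A + φ).hom.hom.hom 12).hom
            ((1 + Complex.I * (Real.sqrt (7 : ℝ) : ℂ)) ^ 12) ⊔
          Module.End.eigenspace (complexBetti.map (𝟙 A + φ).hom.hom.hom 12).hom
            ((1 - Complex.I * (Real.sqrt (7 : ℝ) : ℂ)) ^ 12)) →
    ∃ (B : AbelianVariety ℂ) (φB : B ⟶ B), B.dim = 2 ∧ φB ≫ φB = -((7 : ℤ) • 𝟙 B) ∧
      (∃ bp bm η : complexBetti B.X 2,
        bp ∈ Module.End.eigenspace (complexBetti.map (𝟙 B + φB).hom.hom.hom 2).hom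
              ((1 + Complex.I * (Real.sqrt (7 : ℝ) : ℂ)) ^ 2) ∧
        bm ∈ Module.End.eigenspace (complexBetti.map (𝟙 B + φB).hom.hom.hom 2).hom
              ((1 - Complex.I * (Real.sqrt (7 : ℝ) : ℂ)) ^ 2) ∧
        IsRationalClass (bp + bm) ∧ IsOfHodgeType 2 B.X 2 1 1 (bp + bm) ∧
        η ∈ algebraicClasses B.X 1 ∧
        cupProduct (show 2 + 2 = 4 from rfl) bp η ≠ 0 ∧
        cupProduct (show 2 + 2 = 4 from rfl) bm η ≠ 0) ∧
      ∃ (𝒳 S : SchemeOver ℂ) (f : 𝒳 ⟶ S),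
        IsSmoothProjectiveFamily f 14 ∧ IrreducibleSpace S.left ∧ AlgebraicGeometry.Smooth S.hom ∧
        ∃ (s₁ : ComplexPoints S) (e₁ : (A.prod B).X ≅ fiberOver f s₁),
          ∀ u : complexBetti (A.prod B).X 14, IsRationalClass u →
            IsOfHodgeType 14 (A.prod B).X 14 7 7 u →
            u ∈ Module.End.eigenspace (complexBetti.map (𝟙 (A.prod B) +
                    AbelianVariety.prodLift (AbelianVariety.fst A B ≫ φ) (AbelianVariety.snd A B ≫ φB)).hom.hom.hom
                    14).hom ((1 + Complex.I * (Real.sqrt (7 : ℝ) : ℂ)) ^ 14) ⊔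
                Module.End.eigenspace (complexBetti.map (𝟙 (A.prod B) +
                    AbelianVariety.prodLift (AbelianVariety.fst A B ≫ φ) (AbelianVariety.snd A B ≫ φB)).hom.hom.hom
                    14).hom ((1 - Complex.I * (Real.sqrt (7 : ℝ) : ℂ)) ^ 14) →
            ∃ 𝒰 : complexBetti 𝒳 14,
              complexBetti.map e₁.hom 14 (complexBetti.map (fiberι f s₁) 14 𝒰) = u ∧
              (∀ s : ComplexPoints S,
                IsRationalClass (complexBetti.map (fiberι f s) 14 𝒰) ∧
                IsOfHodgeType 14 (fiberOver f s) 14 7 7 (complexBetti.map (fiberι f s) 14 𝒰)) ∧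
              (∀ s : ComplexPoints S, ∃ (Ys : AbelianVariety ℂ) (ψs : Ys ⟶ Ys) (es : Ys.X ≅ fiberOver f s),
                Ys.dim = 14 ∧ ψs ≫ ψs = -((7 : ℤ) • 𝟙 Ys) ∧
                complexBetti.map es.hom 14 (complexBetti.map (fiberι f s) 14 𝒰) ∈
                  Module.End.eigenspace (complexBetti.map (𝟙 Ys + ψs).hom.hom.hom 14).hom
                      ((1 + Complex.I * (Real.sqrt (7 : ℝ) : ℂ)) ^ 14) ⊔
                    Module.End.eigenspace (complexBetti.map (𝟙 Ys + ψs).hom.hom.hom 14).hom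
                      ((1 - Complex.I * (Real.sqrt (7 : ℝ) : ℂ)) ^ 14)) ∧
              ∃ (s₀ : ComplexPoints S) (Y : AbelianVariety ℂ) (ψ : Y ⟶ Y) (e : Y.X ≅ fiberOver f s₀),
                Y.dim = 14 ∧ ψ ≫ ψ = -((7 : ℤ) • 𝟙 Y) ∧
                (∃ (C : SchemeOver ℂ) (𝒥 : Jacobian C) (σ τ : C ⟶ C) (s t eN : 𝒥.J ⟶ 𝒥.J)
                    (sB tB : AbelianVariety.kerComponent eN ⟶ AbelianVariety.kerComponent eN)
                    (φ' : AbelianVariety.kerComponent (𝟙 (AbelianVariety.kerComponent eN) - tB) ⟶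
                      AbelianVariety.kerComponent (𝟙 (AbelianVariety.kerComponent eN) - tB))
                    (B' : AbelianVariety ℂ) (φB' : B' ⟶ B')
                    (fY : Y ⟶ (AbelianVariety.kerComponent (𝟙 (AbelianVariety.kerComponent eN) - tB)).prod B')
                    (gY : (AbelianVariety.kerComponent (𝟙 (AbelianVariety.kerComponent eN) - tB)).prod B' ⟶ Y)
                    (m : ℕ),
                  IsSmoothProjective 1 C ∧ 𝒥.J.dim = 43 ∧
                  σ ≫ σ ≫ σ ≫ σ ≫ σ ≫ σ ≫ σ = 𝟙 C ∧ τ ≫ τ ≫ τ = 𝟙 C ∧ σ ≫ τ = τ ≫ σ ≫ σ ∧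
                  (∀ P : ComplexPoints C, P ≫ σ ≠ P ∧ P ≫ τ ≠ P) ∧
                  s = 𝒥.pushforward 𝒥 σ ∧ t = 𝒥.pushforward 𝒥 τ ∧
                  eN = 𝟙 𝒥.J + s + s ≫ s + s ≫ s ≫ s + s ≫ s ≫ s ≫ s + s ≫ s ≫ s ≫ s ≫ s +
                    s ≫ s ≫ s ≫ s ≫ s ≫ s ∧
                  sB ≫ AbelianVariety.kerComponentι eN = AbelianVariety.kerComponentι eN ≫ s ∧
                  tB ≫ AbelianVariety.kerComponentι eN = AbelianVariety.kerComponentι eN ≫ t ∧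
                  φ' ≫ AbelianVariety.kerComponentι (𝟙 (AbelianVariety.kerComponent eN) - tB) =
                    AbelianVariety.kerComponentι (𝟙 (AbelianVariety.kerComponent eN) - tB) ≫
                      (sB + sB ≫ sB + sB ≫ sB ≫ sB ≫ sB - sB ≫ sB ≫ sB - sB ≫ sB ≫ sB ≫ sB ≫ sB -
                        sB ≫ sB ≫ sB ≫ sB ≫ sB ≫ sB) ∧
                  B'.dim = 2 ∧ φB' ≫ φB' = -((7 : ℤ) • 𝟙 B') ∧
                  (∀ b : complexBetti B'.X 2,
                    b ∈ Module.End.eigenspace (complexBetti.map (𝟙 B' + φB').hom.hom.hom 2).hom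
                          ((1 + Complex.I * (Real.sqrt (7 : ℝ) : ℂ)) ^ 2) ⊔
                        Module.End.eigenspace (complexBetti.map (𝟙 B' + φB').hom.hom.hom 2).hom
                          ((1 - Complex.I * (Real.sqrt (7 : ℝ) : ℂ)) ^ 2) →
                    b ∈ algebraicClasses B'.X 1) ∧
                  AlgebraicGeometry.Flat fY.hom.hom.hom.left ∧ 0 < m ∧ fY ≫ gY = m • 𝟙 Y ∧
                  gY ≫ ψ = AbelianVariety.prodLift
                    (AbelianVariety.fst (AbelianVariety.kerComponent (𝟙 (AbelianVariety.kerComponent eN) - tB)) B' ≫ φ')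
                    (AbelianVariety.snd (AbelianVariety.kerComponent (𝟙 (AbelianVariety.kerComponent eN) - tB)) B' ≫ φB') ≫
                    gY) ∧
                complexBetti.map e.hom 14 (complexBetti.map (fiberι f s₀) 14 𝒰) ∈
                  Module.End.eigenspace (complexBetti.map (𝟙 Y + ψ).hom.hom.hom 14).hom
                      ((1 + Complex.I * (Real.sqrt (7 : ℝ) : ℂ)) ^ 14) ⊔
                    Module.End.eigenspace (complexBetti.map (𝟙 Y + ψ).hom.hom.hom 14).hom
                      ((1 - Complex.I * (Real.sqrt (7 : ℝ) : ℂ)) ^ 14) := by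
  intro A φ hA hφ hwit
  -- the CM square with its descent pair, algebraic Weil plane and aiming property
  obtain ⟨B, φB, hB, hφB, hpair, hBalg, haim⟩ := exists_cmSquare_descentPair_algebraic_aiming
  refine ⟨B, φB, hB, hφB, hpair, ?_⟩
  -- `A × B` is hyperbolic for a `K`-symmetrised hyperplane class (aiming at `n = 6`)
  have hA' : A.dim = 2 * 6 := hA
  obtain ⟨e, a, ha, ha0, hhyp⟩ := haim 6 A φ (by norm_num) hA' hφ hwit
  set Φ := AbelianVariety.prodLift (AbelianVariety.fst A B ≫ φ) (AbelianVariety.snd A B ≫ φB) with hΦdef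
  have hX : (A.prod B).dim = 2 * 7 := by rw [AbelianVariety.dim_prod, hA, hB]
  have hΦ : Φ ≫ Φ = -(((7 : ℕ) : ℤ) • 𝟙 (A.prod B)) :=
    prodLift_comp_self_eq_neg_zsmul (by exact_mod_cast hφ) (by exact_mod_cast hφB)
  have hhyp' : IsHyperbolicWeilType (A.prod B) Φ 7 (((7 : ℕ) : ℂ) • complexBetti.map e.ι 2 a +
      complexBetti.map Φ.hom.hom.hom 2 (complexBetti.map e.ι 2 a)) := by
    simpa only [Nat.cast_ofNat] using hhyp
  -- (R1): the hyperbolic Weil family through `A × B`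
  obtain ⟨𝒳, S, f, s₁, e₁, Y, Ψ, ε, hfam, hemb, hirr, hsm, hqp, hYs, hsec, hreach⟩ :=
    hR 7 7 (by norm_num) (by norm_num) (A.prod B) Φ e a hX hΦ ha ha0 hhyp'
  refine ⟨𝒳, S, f, hfam, hirr, hsm, s₁, e₁, ?_⟩
  intro u hur _huH huW
  -- `u` lies in the strong Weil plane of `(A × B, Φ)`
  have huW' : u ∈ weilClassesOf (A.prod B) Φ 7 7 := by
    refine stub_upgrade 7 (by norm_num) (by norm_num) le_rfl 7 (A.prod B) Φ hX hΦ ?_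
    exact_mod_cast huW
  -- its flat Weil section, and the global class of the section (W-engine, Deligne 1968)
  obtain ⟨σ, hσc, hσ₁, hσ⟩ := hsec u huW'
  have hpt : ∀ s, (σ s).pt = s := fun s => by
    obtain ⟨x, hx, -⟩ := hσ s
    rw [hx]
  obtain ⟨𝒰, h𝒰⟩ :=
    stub_globalClassOfSection_of_leray hL f (2 * 7) (2 * 7) hfam hemb hsm hqp hirr σ hσc hpt
  have hcls : ∀ (s : ComplexPoints S) (x : complexBetti (fiberOver f s) (2 * 7)),
      σ s = ⟨s, x⟩ → complexBetti.map (fiberι f s) 14 𝒰 = x := by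
    intro s x hx
    have h := (h𝒰 s).symm.trans hx
    simp only [globalSection, FiberClass.mk.injEq, heq_eq_eq, true_and] at h
    exact h
  -- rationality along the section
  have hrat₁ : IsRationalClass (σ s₁).cls := by
    rw [hσ₁]
    exact hur.map _
  have hratσ : ∀ s, IsRationalClass (σ s).cls :=
    stub_rationalAlongSection f (2 * 7) (2 * 7) hfam hsm hqp hirr σ hσc hpt s₁ hrat₁
  refine ⟨𝒰, ?_, ?_, ?_, ?_⟩
  · -- restriction to the fibre `𝒳_{s₁} ≅ A × B`
    rw [hcls s₁ _ hσ₁, ← CategoryTheory.comp_apply, ← complexBetti.map_comp, Iso.hom_inv_id,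
      complexBetti.map_id]
    rfl
  · -- rational and of Hodge type `(7,7)` on every fibre
    intro s
    obtain ⟨x, hx, hxH, -⟩ := hσ s
    have h₁ := hratσ s
    rw [hx] at h₁
    rw [hcls s x hx]
    exact ⟨h₁, hxH⟩
  · -- a Weil class of the fibre's `ℚ(√-7)`-structure on every fibre
    intro s
    obtain ⟨x, hx, -, hxW⟩ := hσ s
    obtain ⟨hYdim, hΨ⟩ := hYs s
    refine ⟨Y s, Ψ s, ε s, hYdim, by exact_mod_cast hΨ, ?_⟩
    rw [hcls s x hx]
    exact_mod_cast mem_eigenspace_sup_of_mem_weilClassesOf hxW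
  · -- the Hecke–Prym-product anchor fibre
    obtain ⟨C, 𝒥, σC, τC, sJ, tJ, eN, sB, tB, φ', hC, hg, hσ7, hτ3, hrel, hfree, hs, ht, heN, hsB, htB,
      hφ', hPdim, hφ'sq, hPwit⟩ := hP
    have hPdim' : (AbelianVariety.kerComponent (𝟙 (AbelianVariety.kerComponent eN) - tB)).dim = 2 * 6 :=
      hPdim
    obtain ⟨e', a', ha', ha0', hhypP⟩ := haim 6 _ φ' (by norm_num) hPdim' hφ'sq hPwit
    set ΨP := AbelianVariety.prodLift
      (AbelianVariety.fst (AbelianVariety.kerComponent (𝟙 (AbelianVariety.kerComponent eN) - tB)) B ≫ φ')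
      (AbelianVariety.snd (AbelianVariety.kerComponent (𝟙 (AbelianVariety.kerComponent eN) - tB)) B ≫ φB)
      with hΨPdef
    have hXP : ((AbelianVariety.kerComponent (𝟙 (AbelianVariety.kerComponent eN) - tB)).prod B).dim =
        2 * 7 := by
      rw [AbelianVariety.dim_prod, hPdim, hB]
    have hΨP : ΨP ≫ ΨP =
        -(((7 : ℕ) : ℤ) • 𝟙 ((AbelianVariety.kerComponent (𝟙 (AbelianVariety.kerComponent eN) - tB)).prod B)) :=
      prodLift_comp_self_eq_neg_zsmul (by exact_mod_cast hφ'sq) (by exact_mod_cast hφB)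
    have hhypP' : IsHyperbolicWeilType _ ΨP 7 (((7 : ℕ) : ℂ) • complexBetti.map e'.ι 2 a' +
        complexBetti.map ΨP.hom.hom.hom 2 (complexBetti.map e'.ι 2 a')) := by
      simpa only [Nat.cast_ofNat] using hhypP
    obtain ⟨s₀, fY, gY, m, hflat, hm, hfg, hgψ⟩ := hreach _ ΨP e' a' hXP hΨP ha' ha0' hhypP'
    obtain ⟨x₀, hx₀, -, hx₀W⟩ := hσ s₀
    obtain ⟨hYdim, hΨ⟩ := hYs s₀
    refine ⟨s₀, Y s₀, Ψ s₀, ε s₀, hYdim, by exact_mod_cast hΨ,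
      ⟨C, 𝒥, σC, τC, sJ, tJ, eN, sB, tB, φ', B, φB, fY, gY, m, hC, hg, hσ7, hτ3, hrel, hfree, hs, ht,
        heN, hsB, htB, hφ', hB, hφB, hBalg, hflat, hm, hfg, hgψ⟩, ?_⟩
    rw [hcls s₀ x₀ hx₀]
    exact_mod_cast mem_eigenspace_sup_of_mem_weilClassesOf hx₀W

end Summit.HodgeConjecture.HodgeConjecture.Theorems.WeilTwelvefoldsSqrtMinus7.IsotypicUnimodularSaturation

end
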